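import Summits.ValiantsHypothesis.ValiantsHypothesis.Theorems.FifoMatchingNNDivisionHardLocatedRowsPermutahedron
import HarnessLib

/-!
# LOCATED ROWS — part 7/8 — §5 the obstruction (private generators are invisible to every located row) and §5b ★★ the CEILING of the pin method: cubes carrying `U`-internal zero-diagonal generators `E^s_{kl} − E^s_{km}` (the `Z_mix` shape, `n ≥ 6`) are NOT pin-exposed

Theorems-side port (staged by val-idea-40 g5 for the desk's P-W6b hand; declaration texts VERBATIM, namespace `…Theorems.FifoMatching.LocatedRows`) of val-idea-40 g5's crux workfile `Cruxes/NNDivisionHard/LocatedRows.lean` REV 5 @4b120a7727c3 (sha16 18e097fc3d9fe11e, 1953 l.; critic of record val-idea-crit-9 g2 VERDICTS #48 / #54 / #58: VERIFIED KEEP, axioms standard), split by the 400-line cap into seven chained modules `…RowFamilies` (§1, §2, §4e-frame) → `…LocatedRowsZeroDiag` (§3) → `…LocatedRowsPairPencil` (§4) → `…LocatedRowsPinExposed` (§4b) → `…LocatedRowsColumnCoupled` (§4c) → `…LocatedRowsPermutahedron` (§4c′, §4d) → `…LocatedRowsCeiling` (§5, §5b).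

* `LocatedAt`, `Private`, `located_dot_private`, `zgen`, `zgen_private`, `located_blind_zgen`; `flat_dotProduct_udPt_eq`, `mixed_diff`, `tight_dot_zgen`, `udRow_pair_dot_zgen_pos/neg`, ★★ `not_pinExposed_of_zgen`, ★★ `not_pinExposed_of_allTriples`.

HONEST LABEL: helper rows for an OPEN crux (21181 `NNDivisionHard` OPEN; `ExactPencilLaw`, `allRows.Law`, COR-VIRTUAL OPEN); the `Law`s are `Prop`-valued definitions, nothing open is asserted; VP ≠ VNP is NOT proved.
-/

set_option autoImplicit false

-- the mandated summit-side namespace repeats a component by design (single-problem summit)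
set_option linter.dupNamespace false

noncomputable section

open Matrix Finset
open scoped Pointwise

namespace Summit.ValiantsHypothesis.ValiantsHypothesis.Theorems.FifoMatching.LocatedRows

open Literature.Barriers.PneNP (HasEFOfSize three_pow_le_card_mul_two_pow_of_cover_univ)
open Literature.Combinatorics.Optimization.FixedSizePsdRank (Cube bvec flat vecOuter corPolytope flat_dotProduct_vecOuter
  flat_dotProduct_le_of_mem_corPolytope)
open Summit.ValiantsHypothesis.ValiantsHypothesis.Theorems.FifoMatching.XcDivision
  (udInd udPt udRow udMat udInd_apply udInd_sq udInd_inter ud_data udRow_dotProduct_flat_diagonal flat_dotProduct_flat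
    dot_le_of_mem_convexHull)
open Summit.ValiantsHypothesis.Theorems.NNDivisionHardNegative.CliqueRowBlind (sum_udInd_mem sum_udInd_univ)
open Summit.ValiantsHypothesis.ValiantsHypothesis.Theorems.FifoMatching.GridCorShadow (four_T_lt_two_pow)
open Summit.ValiantsHypothesis.Theorems.NNDivisionHardNegative.DiagTilted
  (qOff qOffMat qOff_eq hasEFOfSize_qOff udRow_dotProduct_qOff udInd_compl udInd_univ)

/-! ## §5 The obstruction, typed: private generators are invisible to every located row -/

section Obstruction
variable {n : ℕ}

/-- `W` is (normalised-)LOCATED at the coordinate face `F_{S,S'} = {b ⊇ S, b ∩ S' = ∅}` (free block `U = (S ∪ S')ᶜ`): it is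
orthogonal to the face's affine span — no off-diagonal entries inside `U × U`, and `W_mm = −Σ_{i∈S}(W_im + W_mi)` for `m ∈ U`.
(Every direction in the normal cone of `F_{S,S'}` satisfies this after symmetrisation.) -/
def LocatedAt (S S' : Finset (Fin n)) (W : Matrix (Fin n) (Fin n) ℝ) : Prop :=
  (∀ p, p ∉ S ∪ S' → ∀ q, q ∉ S ∪ S' → p ≠ q → W p q = 0) ∧
    (∀ p, p ∉ S ∪ S' → W p p = -∑ i ∈ S, (W i p + W p i))

/-- `g` is PRIVATE at `(S,S')`: it vanishes on `(S∪S')²` and on `S' × U ∪ U × S'`, and on `S × U` it is column-constant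
`g_im = g_mi = g_mm`.  (The `U`-internal zero-diagonal generators are private; so is nothing with a diagonal entry in `U` unless
its `S`-rows copy that entry.) -/
def Private (S S' : Finset (Fin n)) (g : Matrix (Fin n) (Fin n) ℝ) : Prop :=
  (∀ p ∈ S ∪ S', ∀ q ∈ S ∪ S', g p q = 0) ∧
    (∀ p ∈ S', ∀ q, q ∉ S ∪ S' → g p q = 0 ∧ g q p = 0) ∧
    (∀ p ∈ S, ∀ q, q ∉ S ∪ S' → g p q = g q q ∧ g q p = g q q)

/-- ★ **PRIVATE GENERATORS ARE INVISIBLE TO LOCATED ROWS**: `⟨W, g⟩ = 0` whenever `W` is located at `F_{S,S'}` and `g` is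
private there (`S ∩ S' = ∅`).  Consequence (paper, card): on an affine-cube / zonotope passenger a located tilt makes the cube
coordinate of a generator `g` COMMON iff `⟨W, g⟩ ≠ 0`; private generators keep PRIVATE maximisers, and for `Z_mix` the rows
sharing a chamber form a laminar family — no coordinate-located hitting certificate at any codimension. -/
theorem located_dot_private {S S' : Finset (Fin n)} (hSS : Disjoint S S') {W g : Matrix (Fin n) (Fin n) ℝ}
    (hW : LocatedAt S S' W) (hg : Private S S' g) : flat W ⬝ᵥ flat g = 0 := by
  classical
  rw [flat_dotProduct_flat]
  obtain ⟨hWU, hWd⟩ := hW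
  obtain ⟨hg0, hgS', hgS⟩ := hg
  -- rewrite every entry product as a function supported on `S × U ∪ U × S ∪ diag(U)`
  let U : Finset (Fin n) := (S ∪ S')ᶜ
  have hmemU : ∀ p, p ∈ U ↔ p ∉ S ∪ S' := fun p => Finset.mem_compl
  -- per-row computation
  have hrow : ∀ p, ∑ q, W p q * g p q =
      (if p ∈ S then ∑ q ∈ U, W p q * g q q else 0) +
      (if p ∈ U then W p p * g p p + ∑ i ∈ S, W p i * g p p else 0) := by
    intro p
    by_cases hpS : p ∈ S
    · have hpU : p ∉ U := fun h => (hmemU p).1 h (Finset.mem_union_left _ hpS)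
      rw [if_pos hpS, if_neg hpU, add_zero]
      rw [← Finset.sum_add_sum_compl (S ∪ S')]
      have h1 : ∑ q ∈ S ∪ S', W p q * g p q = 0 :=
        Finset.sum_eq_zero fun q hq => by rw [hg0 p (Finset.mem_union_left _ hpS) q hq, mul_zero]
      rw [h1, zero_add]
      exact Finset.sum_congr rfl fun q hq => by rw [(hgS p hpS q ((hmemU q).1 hq)).1]
    by_cases hpS' : p ∈ S'
    · have hpU : p ∉ U := fun h => (hmemU p).1 h (Finset.mem_union_right _ hpS')
      rw [if_neg hpS, if_neg hpU, add_zero]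
      refine Finset.sum_eq_zero fun q _ => ?_
      by_cases hq : q ∈ S ∪ S'
      · rw [hg0 p (Finset.mem_union_right _ hpS') q hq, mul_zero]
      · rw [(hgS' p hpS' q hq).1, mul_zero]
    · have hpSS : p ∉ S ∪ S' := by rw [Finset.mem_union]; push Not; exact ⟨hpS, hpS'⟩
      have hpU : p ∈ U := (hmemU p).2 hpSS
      rw [if_neg hpS, if_pos hpU, zero_add]
      rw [← Finset.sum_add_sum_compl (S ∪ S')]
      have h1 : ∑ q ∈ S ∪ S', W p q * g p q = ∑ i ∈ S, W p i * g p p := by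
        rw [Finset.sum_union hSS]
        have h2 : ∑ q ∈ S', W p q * g p q = 0 :=
          Finset.sum_eq_zero fun q hq => by rw [(hgS' q hq p hpSS).2, mul_zero]
        rw [h2, add_zero]
        exact Finset.sum_congr rfl fun i hi => by rw [(hgS i hi p hpSS).2]
      rw [h1]
      have h3 : ∑ q ∈ (S ∪ S')ᶜ, W p q * g p q = W p p * g p p := by
        rw [Finset.sum_eq_single p]
        · intro q hq hqp
          rw [hWU p hpSS q ((hmemU q).1 hq) (Ne.symm hqp), zero_mul]
        · intro h; exact absurd hpU h
      rw [h3, add_comm]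
  rw [Finset.sum_congr rfl fun p _ => hrow p, Finset.sum_add_distrib]
  -- first block: Σ_{p∈S} Σ_{q∈U} W p q g q q ; second block: Σ_{p∈U} (W p p + Σ_{i∈S} W p i) g p p
  rw [Finset.sum_ite_mem, Finset.univ_inter, Finset.sum_ite_mem, Finset.univ_inter]
  have hsecond : ∑ p ∈ U, (W p p * g p p + ∑ i ∈ S, W p i * g p p) = -∑ p ∈ U, ∑ i ∈ S, W i p * g p p := by
    rw [← Finset.sum_neg_distrib]
    refine Finset.sum_congr rfl fun p hp => ?_
    rw [hWd p ((hmemU p).1 hp)]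
    simp only [Finset.sum_add_distrib, neg_add, add_mul, neg_mul, Finset.sum_mul]
    ring
  rw [hsecond, Finset.sum_comm]
  ring

/-- the `Z_mix` generator `E^s_{kl} − E^s_{km}` as a matrix. -/
def zgen (k l m : Fin n) : Matrix (Fin n) (Fin n) ℝ := fun p q =>
  (if (p = k ∧ q = l) ∨ (p = l ∧ q = k) then (1 : ℝ) else 0) - (if (p = k ∧ q = m) ∨ (p = m ∧ q = k) then 1 else 0)

/-- ★ the `U`-internal `Z_mix` generators are PRIVATE at every coordinate face avoiding their three indices. -/
theorem zgen_private {S S' : Finset (Fin n)} {k l m : Fin n} (hk : k ∉ S ∪ S') (hl : l ∉ S ∪ S') (hm : m ∉ S ∪ S')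
    (hkl : k ≠ l) (hkm : k ≠ m) : Private S S' (zgen k l m) := by
  refine ⟨fun p hp q hq => ?_, fun p hp q hq => ⟨?_, ?_⟩, fun p hp q hq => ⟨?_, ?_⟩⟩
  · have hpk : p ≠ k := fun h => hk (h ▸ hp)
    have hpl : p ≠ l := fun h => hl (h ▸ hp)
    have hpm : p ≠ m := fun h => hm (h ▸ hp)
    simp [zgen, hpk, hpl, hpm]
  · have hp' : p ∈ S ∪ S' := Finset.mem_union_right _ hp
    have hpk : p ≠ k := fun h => hk (h ▸ hp')
    have hpl : p ≠ l := fun h => hl (h ▸ hp')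
    have hpm : p ≠ m := fun h => hm (h ▸ hp')
    simp [zgen, hpk, hpl, hpm]
  · have hp' : p ∈ S ∪ S' := Finset.mem_union_right _ hp
    have hpk : p ≠ k := fun h => hk (h ▸ hp')
    have hpl : p ≠ l := fun h => hl (h ▸ hp')
    have hpm : p ≠ m := fun h => hm (h ▸ hp')
    simp [zgen, hpk, hpl, hpm]
  · have hp' : p ∈ S ∪ S' := Finset.mem_union_left _ hp
    have hpk : p ≠ k := fun h => hk (h ▸ hp')
    have hpl : p ≠ l := fun h => hl (h ▸ hp')
    have hpm : p ≠ m := fun h => hm (h ▸ hp')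
    have hd : zgen k l m q q = 0 := by
      have h1 : ¬ ((q = k ∧ q = l) ∨ (q = l ∧ q = k)) := by
        rintro (⟨h, h'⟩ | ⟨h, h'⟩)
        · exact hkl (h.symm.trans h')
        · exact hkl (h'.symm.trans h)
      have h2 : ¬ ((q = k ∧ q = m) ∨ (q = m ∧ q = k)) := by
        rintro (⟨h, h'⟩ | ⟨h, h'⟩)
        · exact hkm (h.symm.trans h')
        · exact hkm (h'.symm.trans h)
      simp only [zgen, if_neg h1, if_neg h2, sub_zero]
    rw [hd]; simp [zgen, hpk, hpl, hpm]
  · have hp' : p ∈ S ∪ S' := Finset.mem_union_left _ hp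
    have hpk : p ≠ k := fun h => hk (h ▸ hp')
    have hpl : p ≠ l := fun h => hl (h ▸ hp')
    have hpm : p ≠ m := fun h => hm (h ▸ hp')
    have hd : zgen k l m q q = 0 := by
      have h1 : ¬ ((q = k ∧ q = l) ∨ (q = l ∧ q = k)) := by
        rintro (⟨h, h'⟩ | ⟨h, h'⟩)
        · exact hkl (h.symm.trans h')
        · exact hkl (h'.symm.trans h)
      have h2 : ¬ ((q = k ∧ q = m) ∨ (q = m ∧ q = k)) := by
        rintro (⟨h, h'⟩ | ⟨h, h'⟩)
        · exact hkm (h.symm.trans h')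
        · exact hkm (h'.symm.trans h)
      simp only [zgen, if_neg h1, if_neg h2, sub_zero]
    rw [hd]; simp [zgen, hpk, hpl, hpm]

/-- ★ hence every row located at a coordinate face avoiding `k,l,m` is BLIND to the generator `E^s_kl − E^s_km`. -/
theorem located_blind_zgen {S S' : Finset (Fin n)} (hSS : Disjoint S S') {W : Matrix (Fin n) (Fin n) ℝ}
    (hW : LocatedAt S S' W) {k l m : Fin n} (hk : k ∉ S ∪ S') (hl : l ∉ S ∪ S') (hm : m ∉ S ∪ S')
    (hkl : k ≠ l) (hkm : k ≠ m) : flat W ⬝ᵥ flat (zgen k l m) = 0 :=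
  located_dot_private hSS hW (zgen_private hk hl hm hkl hkm)

end Obstruction

section Ceiling
variable {n : ℕ}

/-! ## §5b ★ The ceiling of the pin method, typed: no PIN-EXPOSURE on a cube carrying `U`-internal `Z_mix` generators

The obstruction of §5 made into a NO-GO for the CLASS of §4b (hence for every certificate of this file at coordinate faces,
in either currency): if an affine-cube passenger carries, inside the complement of EVERY admissible pin set `S`
(`2|S| ≤ n`), a zero-diagonal generator `E^s_{kl} − E^s_{km}` (`k,l,m ∉ S` distinct), then it is NOT pin-exposed.  Mechanism:
(i) a direction `w` tight on the whole face `{b ⊇ S}` has vanishing symmetrised off-diagonal entries inside `U = Sᶜ`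
(mixed second differences of `b ↦ ⟨w, x_b⟩` along the face), so `⟨w, E^s_{kl} − E^s_{km}⟩ = 0` (`tight_dot_zgen`);
(ii) the clique parts of the two admissible rows `a = {k,m}` and `a = {k,l}` see the generator with OPPOSITE signs `±2`
(`udRow_pair_dot_zgen_pos/neg`); (iii) on a cube a common maximiser `P⋆` must contain every generator some row sees
positively and omit every generator some row sees negatively (`dotProduct_cubePt`) — contradiction.  In particular the
all-triples zero-diagonal cube (`Z_mix`-type passengers) is outside `PinExposed` for `n ≥ 6`: the enemy specification for
C⁺_exact handed to W6-R1 is now a theorem about this seat's method, not a remark. -/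

/-- `Σ_j f_j · 𝟙_b(j) = Σ_{j ∈ b} f_j`. -/
theorem sum_mul_udInd (f : Fin n → ℝ) (b : Finset (Fin n)) : ∑ j, f j * udInd b j = ∑ j ∈ b, f j := by
  classical
  simp only [udInd_apply, mul_ite, mul_one, mul_zero]
  rw [Finset.sum_ite_mem, Finset.univ_inter]

/-- `⟨flat C, x_b x_bᵀ⟩ = Σ_{p,q ∈ b} C_{pq}`. -/
theorem flat_dotProduct_udPt_eq (C : Matrix (Fin n) (Fin n) ℝ) (b : Finset (Fin n)) :
    flat C ⬝ᵥ udPt b = ∑ p ∈ b, ∑ q ∈ b, C p q := by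
  rw [show udPt b = vecOuter n (udInd b) from rfl, flat_dotProduct_vecOuter]
  have h1 : ∀ p, ∑ q, C p q * (udInd b p * udInd b q) = (∑ q ∈ b, C p q) * udInd b p := fun p => by
    rw [← sum_mul_udInd (fun q => C p q) b, Finset.sum_mul]
    exact Finset.sum_congr rfl fun q _ => by ring
  simp_rw [h1]
  exact sum_mul_udInd (fun p => ∑ q ∈ b, C p q) b

/-- `flat (A − B) = flat A − flat B`. -/
theorem flat_sub' (A B : Matrix (Fin n) (Fin n) ℝ) : flat (A - B) = flat A - flat B := by
  funext p; simp [flat, Matrix.sub_apply]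

/-- `⟨flat C, E_{kl} + E_{lk}⟩ = C_{kl} + C_{lk}` (through `pv k l = x_{kl} − x_k − x_l`). -/
theorem flat_dotProduct_pv (C : Matrix (Fin n) (Fin n) ℝ) {k l : Fin n} (hkl : k ≠ l) :
    flat C ⬝ᵥ pv k l = C k l + C l k := by
  rw [pv, dotProduct_sub, dotProduct_sub, flat_dotProduct_udPt_eq, flat_dotProduct_udPt_eq, flat_dotProduct_udPt_eq]
  simp only [Finset.sum_pair hkl, Finset.sum_singleton]
  ring

/-- `⟨flat C, E^s_{kl} − E^s_{km}⟩ = (C_{kl} + C_{lk}) − (C_{km} + C_{mk})`. -/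
theorem flat_dotProduct_flat_zgen (C : Matrix (Fin n) (Fin n) ℝ) {k l m : Fin n} (hkl : k ≠ l) (hkm : k ≠ m) :
    flat C ⬝ᵥ flat (zgen k l m) = (C k l + C l k) - (C k m + C m k) := by
  rw [show zgen k l m = pairMat k l 1 - pairMat k m 1 from rfl, flat_sub', flat_pairMat hkl, flat_pairMat hkm, one_smul,
    one_smul, dotProduct_sub, flat_dotProduct_pv C hkl, flat_dotProduct_pv C hkm]

/-- the MIXED SECOND DIFFERENCE of `b ↦ Σ_{p,q∈b} C_{pq}` along `k, l ∉ S` is the symmetrised entry `C_{kl} + C_{lk}`. -/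
theorem mixed_diff (C : Matrix (Fin n) (Fin n) ℝ) {S : Finset (Fin n)} {k l : Fin n} (hk : k ∉ S) (hl : l ∉ S)
    (hkl : k ≠ l) :
    (∑ p ∈ insert k (insert l S), ∑ q ∈ insert k (insert l S), C p q) - (∑ p ∈ insert k S, ∑ q ∈ insert k S, C p q)
      - (∑ p ∈ insert l S, ∑ q ∈ insert l S, C p q) + (∑ p ∈ S, ∑ q ∈ S, C p q) = C k l + C l k := by
  classical
  have hk' : k ∉ insert l S := by simp [hkl, hk]
  simp only [Finset.sum_insert hk', Finset.sum_insert hk, Finset.sum_insert hl, Finset.sum_add_distrib]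
  ring

/-- ★ (i) a direction tight on the whole face `{b ⊇ S}` does not see the `U`-internal zero-diagonal generators. -/
theorem tight_dot_zgen {S : Finset (Fin n)} {w : Fin (n * n) → ℝ}
    (htight : ∀ b : Finset (Fin n), S ⊆ b → w ⬝ᵥ udPt b = w ⬝ᵥ udPt S)
    {k l m : Fin n} (hk : k ∉ S) (hl : l ∉ S) (hm : m ∉ S) (hkl : k ≠ l) (hkm : k ≠ m) :
    w ⬝ᵥ flat (zgen k l m) = 0 := by
  classical
  have hval : ∀ b : Finset (Fin n), S ⊆ b → ∑ p ∈ b, ∑ q ∈ b, unflat w p q = ∑ p ∈ S, ∑ q ∈ S, unflat w p q := by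
    intro b hb
    rw [← flat_dotProduct_udPt_eq, ← flat_dotProduct_udPt_eq, flat_unflat]
    exact htight b hb
  have hsub : ∀ x : Fin n, S ⊆ insert x S := fun x => Finset.subset_insert x S
  have hsym : ∀ {x : Fin n}, x ∉ S → k ≠ x → unflat w k x + unflat w x k = 0 := by
    intro x hx hkx
    rw [← mixed_diff (unflat w) hk hx hkx, hval _ ((hsub x).trans (Finset.subset_insert k _)), hval _ (hsub k),
      hval _ (hsub x)]
    ring
  rw [← flat_unflat w, flat_dotProduct_flat_zgen _ hkl hkm, hsym hl hkl, hsym hm hkm, sub_self]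

/-- (ii) the clique part of the row `a = {k, m}` sees `E^s_{kl} − E^s_{km}` with coefficient `+2` … -/
theorem udRow_pair_dot_zgen_pos {k l m : Fin n} (hkl : k ≠ l) (hkm : k ≠ m) (hlm : l ≠ m) :
    udRow {k, m} ⬝ᵥ flat (zgen k l m) = 2 := by
  classical
  rw [show udRow {k, m} = flat (udMat {k, m}) from rfl, flat_dotProduct_flat_zgen _ hkl hkm]
  simp [udMat, udInd_apply, hkl, hkl.symm, hkm, hkm.symm, hlm]
  norm_num

/-- … and the clique part of the row `a = {k, l}` sees it with coefficient `−2`. -/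
theorem udRow_pair_dot_zgen_neg {k l m : Fin n} (hkl : k ≠ l) (hkm : k ≠ m) (hlm : l ≠ m) :
    udRow {k, l} ⬝ᵥ flat (zgen k l m) = -2 := by
  classical
  rw [show udRow {k, l} = flat (udMat {k, l}) from rfl, flat_dotProduct_flat_zgen _ hkl hkm]
  simp [udMat, udInd_apply, hkl, hkl.symm, hkm, hkm.symm, hlm.symm]
  norm_num

/-- ★★ **NO PIN-EXPOSURE ON A CUBE WITH `U`-INTERNAL ZERO-DIAGONAL GENERATORS** (the ceiling of §4b's class, typed): if for
every admissible pin set `S` some generator of the cube is `E^s_{kl} − E^s_{km}` with `k, l, m ∉ S` distinct, the passenger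
(listed surjectively) is not `PinExposed`. -/
theorem not_pinExposed_of_zgen {N K : ℕ} (Q₀ : Matrix (Fin n) (Fin n) ℝ) (G : Fin N → Matrix (Fin n) (Fin n) ℝ)
    (e : Fin (K + 1) → Finset (Fin N)) (he : Function.Surjective e)
    (hgen : ∀ S : Finset (Fin n), 2 * S.card ≤ n →
      ∃ (t : Fin N) (k l m : Fin n), k ∉ S ∧ l ∉ S ∧ m ∉ S ∧ k ≠ l ∧ k ≠ m ∧ l ≠ m ∧ G t = zgen k l m) :
    ¬ PinExposed n K (cubePt Q₀ G ∘ e) := by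
  classical
  rintro ⟨S, w, jstar, hS, -, htight, hmax⟩
  obtain ⟨t, k, l, m, hk, hl, hm, hkl, hkm, hlm, hG⟩ := hgen S hS
  have hw0 : w ⬝ᵥ flat (G t) = 0 := by rw [hG]; exact tight_dot_zgen htight hk hl hm hkl hkm
  have hrow : ∀ a : Finset (Fin n), (udRow a + w) ⬝ᵥ flat (G t) = udRow a ⬝ᵥ flat (zgen k l m) := fun a => by
    rw [add_dotProduct, hw0, add_zero, hG]
  have hsub : ∀ {x y : Fin n}, x ∉ S → y ∉ S → ({x, y} : Finset (Fin n)) ⊆ Sᶜ := by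
    intro x y hx hy z hz
    rw [Finset.mem_compl]
    rcases Finset.mem_insert.1 hz with rfl | hz
    · exact hx
    · rw [Finset.mem_singleton] at hz; subst hz; exact hy
  -- value of a row at a cube vertex, split at the generator `t`
  have hval : ∀ (ρ : Fin (n * n) → ℝ) (P : Finset (Fin N)), t ∉ P →
      ρ ⬝ᵥ cubePt Q₀ G (insert t P) = ρ ⬝ᵥ cubePt Q₀ G P + ρ ⬝ᵥ flat (G t) := fun ρ P ht => by
    rw [dotProduct_cubePt, dotProduct_cubePt, Finset.sum_insert ht]
    ring
  by_cases ht : t ∈ e jstar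
  · -- the row `{k,l}` (coefficient −2) improves by dropping `t`
    obtain ⟨j', hj'⟩ := he ((e jstar).erase t)
    have h1 := hmax {k, l} (hsub hk hl) j'
    simp only [Function.comp_apply, hj'] at h1
    have h2 := hval (udRow {k, l} + w) ((e jstar).erase t) (Finset.notMem_erase t _)
    rw [Finset.insert_erase ht, hrow, udRow_pair_dot_zgen_neg hkl hkm hlm] at h2
    linarith
  · -- the row `{k,m}` (coefficient +2) improves by adding `t`
    obtain ⟨j', hj'⟩ := he (insert t (e jstar))
    have h1 := hmax {k, m} (hsub hk hm) j'
    simp only [Function.comp_apply, hj'] at h1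
    have h2 := hval (udRow {k, m} + w) (e jstar) ht
    rw [hrow, udRow_pair_dot_zgen_pos hkl hkm hlm] at h2
    linarith

/-- ★★ COROLLARY (`Z_mix`-type passengers): for `n ≥ 6`, an affine cube whose generators include `E^s_{kl} − E^s_{km}` for EVERY
triple of distinct indices is NOT pin-exposed — every admissible pin set leaves `|Sᶜ| ≥ 3` free indices. -/
theorem not_pinExposed_of_allTriples (hn : 6 ≤ n) {N K : ℕ} (Q₀ : Matrix (Fin n) (Fin n) ℝ)
    (G : Fin N → Matrix (Fin n) (Fin n) ℝ) (e : Fin (K + 1) → Finset (Fin N)) (he : Function.Surjective e)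
    (hall : ∀ k l m : Fin n, k ≠ l → k ≠ m → l ≠ m → ∃ t, G t = zgen k l m) :
    ¬ PinExposed n K (cubePt Q₀ G ∘ e) := by
  classical
  refine not_pinExposed_of_zgen Q₀ G e he fun S hS => ?_
  have hc : 2 < Sᶜ.card := by
    rw [Finset.card_compl, Fintype.card_fin]; omega
  obtain ⟨k, l, m, hk, hl, hm, hkl, hkm, hlm⟩ := Finset.two_lt_card_iff.1 hc
  rw [Finset.mem_compl] at hk hl hm
  obtain ⟨t, ht⟩ := hall k l m hkl hkm hlm
  exact ⟨t, k, l, m, hk, hl, hm, hkl, hkm, hlm, ht⟩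

end Ceiling

end Summit.ValiantsHypothesis.ValiantsHypothesis.Theorems.FifoMatching.LocatedRows
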